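import Mathlib
import Literature.Probability.RandomPlanarGeometry.LatticeSimilarityCovariance

/-!
# Crux `CardyRotToConfR2SymmetryUpgrade`, line `isotropy-kills-beltrami`: the group lemma (S4b)

Stub `stub_similarityConjugateRigidity` of the line skeleton for crux stmt-CriticalPhenomena-0698.

**Statement.** A homeomorphism `Φ` of the plane which conjugates every orientation-preserving
similarity `S : z ↦ c z + w` (`c ≠ 0`) into a similarity `z ↦ c' z + w'` or an anti-similarity
`z ↦ c' z̄ + w'` is itself a similarity or an anti-similarity.

**Proof** (elementary plane topology and linear algebra; nothing about SLE).
* `conjugate_pointwise`: the hypothesis in pointwise form, `Φ (c y + w) = c' Φ y + w'` or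
  `Φ (c y + w) = c' conj (Φ y) + w'` for all `y`.
* `exists_translate_affine`: the conjugate `T_w = Φ τ_w Φ⁻¹` of the translation `τ_w` is the
  square of `T_{w/2}`, and the square of a map `x ↦ a x + b` or `x ↦ a x̄ + b` is of the form
  `x ↦ α x + β` (`half_translate_sq`).
* `translate_eq`: `T_w` is fixed-point free for `w ≠ 0` (it is conjugate to `τ_w`), while
  `x ↦ α x + β` fixes `β / (1 - α)` unless `α = 1`; so `T_w` is the translation by
  `L w := Φ w - Φ 0`, i.e. `Φ (y + w) = Φ y + L w`.
* `stub_similarityConjugateRigidity`: `L` is additive and continuous, hence real-linear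
  (`map_real_smul`), and `Φ = L + Φ 0`; conjugating multiplication by `i` gives
  `L (i y) = a L y` or `L (i y) = a conj (L y)`; iterating, `-L 1 = a² L 1`, resp.
  `-L 1 = |a|² L 1`; the second is impossible (`L 1 ≠ 0` by injectivity of `Φ`), the first gives
  `a = ± i`, i.e. `L z = L 1 · z` (`Φ = similarity (L 1) _ (Φ 0)`) or `L z = L 1 · z̄`
  (`Φ = Complex.conjLIE.toHomeomorph.trans (similarity (L 1) _ (Φ 0))`).

Conventions: `Homeomorph.trans f g = g ∘ f`, so `Φ.symm.trans (S.trans Φ) = Φ ∘ S ∘ Φ⁻¹`;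
`similarity c hc w z = c * z + w` (`similarity_apply`) and
`(Complex.conjLIE.toHomeomorph.trans (similarity c hc w)) z = c * conj z + w`
(`conjLIE_toHomeomorph_trans_similarity_apply`), both from
`Literature.Probability.RandomPlanarGeometry`.
-/

noncomputable section

namespace Summit.CriticalPhenomena.CardyFormulaZ2.Theorems.CardyRotToConfR2SymmetryUpgrade.IsotropyKillsBeltrami

open Literature.Probability.RandomPlanarGeometry
open scoped ComplexConjugate
open Complex (I)

/-- Pointwise form of the conjugation hypothesis: if `Φ ∘ S ∘ Φ⁻¹`, `S z = c z + w`, is the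
similarity `z ↦ c' z + w'` or the anti-similarity `z ↦ c' z̄ + w'`, then for every `y`,
`Φ (c y + w) = c' Φ y + w'`, resp. `Φ (c y + w) = c' conj (Φ y) + w'`. -/
theorem conjugate_pointwise (Φ : ℂ ≃ₜ ℂ) {c : ℂ} (hc : c ≠ 0) (w : ℂ) {c' : ℂ} (hc' : c' ≠ 0)
    (w' : ℂ)
    (h : Φ.symm.trans ((similarity c hc w).trans Φ) = similarity c' hc' w' ∨
      Φ.symm.trans ((similarity c hc w).trans Φ) =
        Complex.conjLIE.toHomeomorph.trans (similarity c' hc' w')) :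
    (∀ y, Φ (c * y + w) = c' * Φ y + w') ∨ (∀ y, Φ (c * y + w) = c' * conj (Φ y) + w') := by
  refine h.imp (fun h y => ?_) (fun h y => ?_)
  · have hy := DFunLike.congr_fun h (Φ y)
    simpa only [Homeomorph.trans_apply, Homeomorph.symm_apply_apply, similarity_apply] using hy
  · have hy := DFunLike.congr_fun h (Φ y)
    simpa only [Homeomorph.trans_apply, Homeomorph.symm_apply_apply, similarity_apply,
      conjLIE_toHomeomorph_apply] using hy

/-- The square of a map of the form `x ↦ a x + b` or `x ↦ a x̄ + b` (here `Φ τ_v Φ⁻¹`, written on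
the points `x = Φ y`) is of the form `x ↦ α x + β`. -/
theorem half_translate_sq (Φ : ℂ ≃ₜ ℂ) (v : ℂ) {a b : ℂ}
    (h : (∀ y, Φ (y + v) = a * Φ y + b) ∨ (∀ y, Φ (y + v) = a * conj (Φ y) + b)) :
    ∃ α β : ℂ, ∀ y, Φ (y + v + v) = α * Φ y + β := by
  rcases h with h | h
  · exact ⟨a * a, a * b + b, fun y => by rw [h (y + v), h y]; ring⟩
  · refine ⟨a * conj a, a * conj b + b, fun y => ?_⟩
    rw [h (y + v), h y, map_add, map_mul, Complex.conj_conj]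
    ring

/-- The conjugate `Φ τ_w Φ⁻¹` of the translation `τ_w` by a homeomorphism `Φ` conjugating
similarities into (anti)similarities is, on points, of the form `x ↦ α x + β`:
`Φ (y + w) = α Φ y + β` for all `y` (it is the square of `Φ τ_{w/2} Φ⁻¹`). -/
theorem exists_translate_affine (Φ : ℂ ≃ₜ ℂ)
    (hΦ : ∀ (c : ℂ) (hc : c ≠ 0) (w : ℂ), ∃ (c' : ℂ) (hc' : c' ≠ 0) (w' : ℂ),
      Φ.symm.trans ((similarity c hc w).trans Φ) = similarity c' hc' w' ∨
      Φ.symm.trans ((similarity c hc w).trans Φ) =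
        Complex.conjLIE.toHomeomorph.trans (similarity c' hc' w'))
    (w : ℂ) : ∃ α β : ℂ, ∀ y, Φ (y + w) = α * Φ y + β := by
  obtain ⟨c', hc', w', h⟩ := hΦ 1 one_ne_zero (w / 2)
  have h2 := conjugate_pointwise Φ one_ne_zero (w / 2) hc' w' h
  simp only [one_mul] at h2
  obtain ⟨α, β, hαβ⟩ := half_translate_sq Φ (w / 2) h2
  exact ⟨α, β, fun y => by rw [← hαβ y, add_assoc, add_halves]⟩

/-- Conjugates of translations are translations: `Φ (y + w) = Φ y + (Φ w - Φ 0)` for all `w, y`.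
Indeed `Φ τ_w Φ⁻¹ : x ↦ α x + β` (`exists_translate_affine`) has the fixed point `β / (1 - α)`
unless `α = 1`, while for `w ≠ 0` it is fixed-point free, being conjugate to `τ_w`. -/
theorem translate_eq (Φ : ℂ ≃ₜ ℂ)
    (hΦ : ∀ (c : ℂ) (hc : c ≠ 0) (w : ℂ), ∃ (c' : ℂ) (hc' : c' ≠ 0) (w' : ℂ),
      Φ.symm.trans ((similarity c hc w).trans Φ) = similarity c' hc' w' ∨
      Φ.symm.trans ((similarity c hc w).trans Φ) =
        Complex.conjLIE.toHomeomorph.trans (similarity c' hc' w'))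
    (w y : ℂ) : Φ (y + w) = Φ y + (Φ w - Φ 0) := by
  rcases eq_or_ne w 0 with rfl | hw
  · rw [add_zero, sub_self, add_zero]
  obtain ⟨α, β, hαβ⟩ := exists_translate_affine Φ hΦ w
  have hα : α = 1 := by
    by_contra hα
    have h1α : (1 - α) ≠ 0 := sub_ne_zero.mpr (Ne.symm hα)
    have hx : β / (1 - α) * (1 - α) = β := div_mul_cancel₀ β h1α
    have hfix : α * (β / (1 - α)) + β = β / (1 - α) := by linear_combination -hx
    have key : Φ (Φ.symm (β / (1 - α)) + w) = Φ (Φ.symm (β / (1 - α))) := by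
      rw [hαβ, Homeomorph.apply_symm_apply]
      exact hfix
    exact hw (add_eq_left.mp (Φ.injective key))
  subst hα
  have hβ : β = Φ w - Φ 0 := by
    have h0 := hαβ 0
    rw [zero_add, one_mul] at h0
    rw [h0]
    ring
  rw [hαβ y, one_mul, hβ]

/-- **The group lemma** (registered stub `stub_similarityConjugateRigidity`, S4b of line
`isotropy-kills-beltrami`). A plane homeomorphism `Φ` which conjugates every
orientation-preserving similarity `S : z ↦ c z + w` into an (anti)similarity
(`Φ ∘ S ∘ Φ⁻¹ = z ↦ c' z + w'` or `z ↦ c' z̄ + w'`) is itself a similarity `z ↦ c z + w` or an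
anti-similarity `z ↦ c z̄ + w`. Proof: by `translate_eq`, `Φ = L + Φ 0` with `L w = Φ w - Φ 0`
additive and continuous, hence real-linear (`map_real_smul`); conjugating multiplication by `i`
shows `L (i y) = a L y` (then `a² = -1`, `a = ± i`, and `L` is complex-linear or antilinear) or
`L (i y) = a conj (L y)` (then `-L 1 = |a|² L 1`, impossible as `L 1 ≠ 0`). -/
theorem stub_similarityConjugateRigidity :
    ∀ Φ : ℂ ≃ₜ ℂ,
      (∀ (c : ℂ) (hc : c ≠ 0) (w : ℂ), ∃ (c' : ℂ) (hc' : c' ≠ 0) (w' : ℂ),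
        Φ.symm.trans ((similarity c hc w).trans Φ) = similarity c' hc' w' ∨
        Φ.symm.trans ((similarity c hc w).trans Φ) =
          Complex.conjLIE.toHomeomorph.trans (similarity c' hc' w')) →
      ∃ (c : ℂ) (hc : c ≠ 0) (w : ℂ), Φ = similarity c hc w ∨
        Φ = Complex.conjLIE.toHomeomorph.trans (similarity c hc w) := by
  intro Φ hΦ
  have htr : ∀ w y, Φ (y + w) = Φ y + (Φ w - Φ 0) := translate_eq Φ hΦ
  -- the additive, continuous, hence real-linear part `L w = Φ w - Φ 0` of `Φ`
  obtain ⟨L, hL⟩ : ∃ L : ℂ →+ ℂ, ∀ w, L w = Φ w - Φ 0 :=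
    ⟨AddMonoidHom.mk' (fun w => Φ w - Φ 0) fun w w' => by
        show Φ (w + w') - Φ 0 = (Φ w - Φ 0) + (Φ w' - Φ 0)
        rw [htr w' w]
        ring,
      fun _ => rfl⟩
  have hLc : Continuous L := (continuous_congr hL).mpr (Φ.continuous.sub continuous_const)
  have hsmul : ∀ (r : ℝ) (z : ℂ), L (r • z) = r • L z := fun r z => map_real_smul L hLc r z
  have hdecomp : ∀ z : ℂ, L z = (z.re : ℂ) * L 1 + (z.im : ℂ) * L I := by
    intro z
    have hz : (z.re : ℝ) • (1 : ℂ) + (z.im : ℝ) • I = z := by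
      rw [Complex.real_smul, Complex.real_smul, mul_one, Complex.re_add_im]
    conv_lhs => rw [← hz]
    rw [map_add, hsmul, hsmul, Complex.real_smul, Complex.real_smul]
  have hL1 : L 1 ≠ 0 := fun h =>
    one_ne_zero (Φ.injective (sub_eq_zero.mp ((hL 1).symm.trans h)))
  have hΦL : ∀ z, Φ z = L z + Φ 0 := fun z => by rw [hL, sub_add_cancel]
  have hconj : ∀ z : ℂ, conj z = (z.re : ℂ) - (z.im : ℂ) * I := fun z =>
    Complex.ext (by simp) (by simp)
  -- conjugating multiplication by `I`
  obtain ⟨a, ha, b, hrot⟩ := hΦ I Complex.I_ne_zero 0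
  have hrot' := conjugate_pointwise Φ Complex.I_ne_zero 0 ha b hrot
  simp only [add_zero] at hrot'
  rcases hrot' with h | h
  · -- `Φ (I y) = a Φ y + b`: the linear part satisfies `L (I y) = a L y`
    have hb : b = Φ 0 - a * Φ 0 := by
      have h0 := h 0
      rw [mul_zero] at h0
      linear_combination -h0
    have hLI : ∀ y, L (I * y) = a * L y := by
      intro y
      rw [hL, hL, h y, hb]
      ring
    have hLI1 : L I = a * L 1 := by rw [← hLI 1, mul_one]
    -- iterate: `-L 1 = a² L 1`, so `a² = -1 = I²`
    have ha2 : a ^ 2 = I ^ 2 := by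
      have h1 : L (I * (I * 1)) = a * (a * L 1) := by rw [hLI, hLI]
      rw [← mul_assoc, Complex.I_mul_I, mul_one, map_neg] at h1
      have h2 : (a ^ 2 + 1) * L 1 = 0 := by linear_combination -h1
      rcases mul_eq_zero.mp h2 with h3 | h3
      · rw [Complex.I_sq]
        linear_combination h3
      · exact absurd h3 hL1
    rcases sq_eq_sq_iff_eq_or_eq_neg.mp ha2 with rfl | rfl
    · -- `L` is complex-linear: `Φ z = L 1 * z + Φ 0`
      refine ⟨L 1, hL1, Φ 0, Or.inl (Homeomorph.ext fun z => ?_)⟩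
      rw [similarity_apply, hΦL z, hdecomp z, hLI1]
      conv_rhs => rw [← Complex.re_add_im z]
      ring
    · -- `L` is complex-antilinear: `Φ z = L 1 * conj z + Φ 0`
      refine ⟨L 1, hL1, Φ 0, Or.inr (Homeomorph.ext fun z => ?_)⟩
      rw [conjLIE_toHomeomorph_trans_similarity_apply, hΦL z, hdecomp z, hLI1, hconj z]
      ring
  · -- `Φ (I y) = a conj (Φ y) + b`: then `L (I y) = a conj (L y)` and `-L 1 = |a|² L 1`: absurd
    exfalso
    have hb : b = Φ 0 - a * conj (Φ 0) := by
      have h0 := h 0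
      rw [mul_zero] at h0
      linear_combination -h0
    have hLI : ∀ y, L (I * y) = a * conj (L y) := by
      intro y
      rw [hL, hL, h y, hb, map_sub]
      ring
    have h1 : L (I * (I * 1)) = a * conj (a * conj (L 1)) := by rw [hLI, hLI]
    rw [← mul_assoc, Complex.I_mul_I, mul_one, map_neg, map_mul, Complex.conj_conj] at h1
    have h2 : ((Complex.normSq a : ℂ) + 1) * L 1 = 0 := by
      rw [← Complex.mul_conj]
      linear_combination -h1
    rcases mul_eq_zero.mp h2 with h3 | h3
    · have h4 := congrArg Complex.re h3
      simp only [Complex.add_re, Complex.ofReal_re, Complex.one_re, Complex.zero_re] at h4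
      linarith [Complex.normSq_nonneg a]
    · exact hL1 h3

end Summit.CriticalPhenomena.CardyFormulaZ2.Theorems.CardyRotToConfR2SymmetryUpgrade.IsotropyKillsBeltrami
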